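import Summits.Ventures.LatticeQCDFlow.Scoring.TorusCovariance2D
import Summits.Ventures.LatticeQCDFlow.Scoring.TorusCovariance2DRows
import Summits.Ventures.LatticeQCDFlow.Scoring.TorusCylinderLimit2D
import HarnessLib

/-!
# The exact non-abelian area law in two dimensions, V-r: separated local observables of `ℤ²` — their torus covariance tends to zero, at every coupling

HONEST FRAMING: exact (Metropolis-corrected) sampling algorithms for lattice gauge theory;
figures of merit are autocorrelation/cost numbers at stated couplings and volumes; no
continuum-physics claim.

Venture `LatticeQCDFlow` (cell pub-lqcd), sub-topic `Scoring`; FANOUT row 5 (`s0-sun-a`), GEN-22.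
NEW WORK of the cell (placement rule).  Setting of `Literature…QuantumLattice.LatticeGaugeDLR`: configurations
`LGConfig 2 G` on the edges of `ℤ²`, cylinder observables `IsCylinder F S`, translations `configShift x`, the
periodic transport `toTorusObservable (L+1) F = F ∘ torusLift (L+1)`, theory-2's torus Wilson states
`wilsonExpectation ρ β` on `(ℤ/(L+1))²`; every compact second-countable gauge group `G`, every continuous
representation `ρ`, EVERY real `β`.

* §1 supports: the base sites of the translated support of `F ∘ θ_x` (`Literature…IsCylinder.comp_configShift`:
  support translated by `−x`) lie in the translated box (`sites_image_shift_sub`); boxes of `ℤ²` (`zbox_mono`);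
* §2 **`eventually_abs_cov_le_of_col_sep`**, **`eventually_abs_cov_le_of_row_sep`** — for two bounded continuous
  cylinder observables whose support boxes are separated by at least one column (row) of plaquettes, the torus
  covariance `⟨Φa Φb⟩_{L+1} − ⟨Φa⟩_{L+1}⟨Φb⟩_{L+1}` of their transports tends to `0` as `L → ∞` — it is
  `O(θ^{(L+1)²})`, exponentially small in the VOLUME (parts VIII-b / VIII-rb: `TorusCovariance2D[Rows]`);
* Sequel `TorusClustering2D`: the Osterwalder–Seiler clustering shape at every coupling, every mass.

No `def`, nothing cited as a fact, 0 sorry.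
-/

noncomputable section

open MeasureTheory Function Finset Filter Topology
open Literature.MathematicalPhysics.QuantumFieldTheory
open Literature.MathematicalPhysics.QuantumLattice
open Summit.Ventures.LatticeQCDFlow.Theory2.Lattice
open Summit.Ventures.LatticeQCDFlow.Theory2.Lattice.TwoDim

namespace Summit.Ventures.LatticeQCDFlow.Scoring

variable {G : Type*} [Group G] [TopologicalSpace G] [IsTopologicalGroup G]
  [CompactSpace G] [SecondCountableTopology G] [MeasurableSpace G] [BorelSpace G] {N : ℕ}
  (ρ : G →* Matrix (Fin N) (Fin N) ℂ)

/-! ## §1. Supports: shifted cylinder observables and boxes of `ℤ²` -/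

section Supports

omit [TopologicalSpace G] [IsTopologicalGroup G] [CompactSpace G] [SecondCountableTopology G]
  [MeasurableSpace G] [BorelSpace G]

omit [Group G] in
/-- The base sites of the translated support lie in the translated box. -/
theorem sites_image_shift_sub {S : Finset ((Literature.MathematicalPhysics.QuantumLattice.ZdEdge 2))}
    {a b : ℤ} {R T : ℕ}
    (hS : ∀ s ∈ S, s.1 ∈ (range R ×ˢ range T).image
      (fun q : ℕ × ℕ => (![a + q.1, b + q.2] : (Literature.Probability.LatticeModels.Site 2))))
    (x : (Literature.Probability.LatticeModels.Site 2)) :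
    ∀ s ∈ S.image (fun e : (Literature.MathematicalPhysics.QuantumLattice.ZdEdge 2) => (e.1 - x, e.2)),
      s.1 ∈ (range R ×ˢ range T).image
      (fun q : ℕ × ℕ => (![a - x 0 + q.1, b - x 1 + q.2] : (Literature.Probability.LatticeModels.Site 2))) := by
  intro s hs
  rw [Finset.mem_image] at hs
  obtain ⟨t, ht, rfl⟩ := hs
  obtain ⟨q, hq, hqt⟩ := Finset.mem_image.1 (hS t ht)
  refine Finset.mem_image.2 ⟨q, hq, ?_⟩
  show (![a - x 0 + q.1, b - x 1 + q.2] : (Literature.Probability.LatticeModels.Site 2)) = t.1 - x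
  rw [← hqt]
  funext k
  have h01 : ∀ k : Fin 2, k = 0 ∨ k = 1 := by decide
  rcases h01 k with rfl | rfl
  · simp only [Matrix.cons_val_zero, Pi.sub_apply]; ring
  · simp only [Matrix.cons_val_one, Matrix.cons_val_fin_one, Pi.sub_apply]; ring

/-- A box of `ℤ²` inside a bigger box. -/
theorem zbox_mono {a b a' b' : ℤ} {R T R' T' : ℕ} (ha : a' ≤ a) (hR : a + R ≤ a' + R') (hb : b' ≤ b)
    (hT : b + T ≤ b' + T') {z : (Literature.Probability.LatticeModels.Site 2)}
    (hz : z ∈ (range R ×ˢ range T).image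
      (fun q : ℕ × ℕ => (![a + q.1, b + q.2] : (Literature.Probability.LatticeModels.Site 2)))) :
    z ∈ (range R' ×ˢ range T').image
      (fun q : ℕ × ℕ => (![a' + q.1, b' + q.2] : (Literature.Probability.LatticeModels.Site 2))) := by
  obtain ⟨⟨q₁, q₂⟩, hq, rfl⟩ := Finset.mem_image.1 hz
  rw [Finset.mem_product, Finset.mem_range, Finset.mem_range] at hq
  refine Finset.mem_image.2 ⟨((a - a' + q₁).toNat, (b - b' + q₂).toNat),
    Finset.mem_product.2 ⟨Finset.mem_range.2 (by omega), Finset.mem_range.2 (by omega)⟩, ?_⟩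
  funext k
  have h01 : ∀ k : Fin 2, k = 0 ∨ k = 1 := by decide
  rcases h01 k with rfl | rfl
  · simp only [Matrix.cons_val_zero]; omega
  · simp only [Matrix.cons_val_one, Matrix.cons_val_fin_one]; omega

end Supports

/-! ## §2. Separated supports: the torus covariance is exponentially small in the volume -/

section Separated

/-- **COLUMN-SEPARATED CYLINDER OBSERVABLES**: if the support boxes of `Fa` (columns `[a, a + Ra)`) and `Fb`
(columns `[a', a' + Rb)`) satisfy `a + Ra + 1 ≤ a'`, then for every `δ > 0`, for all large `L`,
`|⟨Φa Φb⟩_{L+1} − ⟨Φa⟩_{L+1} ⟨Φb⟩_{L+1}| ≤ δ` (`Φ = toTorusObservable (L+1) F`; in fact the covariance is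
`O(θ^{(L+1)²})`, part VIII-b). -/
theorem eventually_abs_cov_le_of_col_sep (hρ : Continuous ρ) (β : ℝ) {Fa Fb : LGConfig 2 G → ℝ}
    {Sa Sb : Finset ((Literature.MathematicalPhysics.QuantumLattice.ZdEdge 2))} (hFa : IsCylinder Fa Sa)
    (hFb : IsCylinder Fb Sb) (hca : Continuous Fa) (hcb : Continuous Fb) {Ca Cb : ℝ}
    (hba : ∀ U, |Fa U| ≤ Ca) (hbb : ∀ U, |Fb U| ≤ Cb) {a b a' b' : ℤ} {Ra Ta Rb Tb : ℕ}
    (hSa : ∀ s ∈ Sa, s.1 ∈ (range Ra ×ˢ range Ta).image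
      (fun q : ℕ × ℕ => (![a + q.1, b + q.2] : (Literature.Probability.LatticeModels.Site 2))))
    (hSb : ∀ s ∈ Sb, s.1 ∈ (range Rb ×ˢ range Tb).image
      (fun q : ℕ × ℕ => (![a' + q.1, b' + q.2] : (Literature.Probability.LatticeModels.Site 2))))
    (hgap : a + Ra + 1 ≤ a') {δ : ℝ} (hδ : 0 < δ) :
    ∀ᶠ L : ℕ in atTop,
      |wilsonExpectation (L := L + 1) ρ β
            (fun U => toTorusObservable (L + 1) Fa U * toTorusObservable (L + 1) Fb U) -
          wilsonExpectation (L := L + 1) ρ β (toTorusObservable (L + 1) Fa) *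
            wilsonExpectation (L := L + 1) ρ β (toTorusObservable (L + 1) Fb)| ≤ δ := by
  obtain ⟨B, hB0, hB⟩ := exists_bound_trace_re_nonneg ρ hρ
  -- common row band and the gap
  set j₀ : ℤ := min b b' with hj₀
  set T₀ : ℕ := (max (b + Ta) (b' + Tb) - j₀).toNat with hT₀
  set k : ℕ := (a' - a - Ra).toNat with hk
  have hk0 : 0 < k := by omega
  have ha' : a' = a + Ra + k := by omega
  have hSa' : ∀ s ∈ Sa, s.1 ∈ (range Ra ×ˢ range T₀).image
      (fun q : ℕ × ℕ => (![a + q.1, j₀ + q.2] : (Literature.Probability.LatticeModels.Site 2))) :=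
    fun s hs => zbox_mono le_rfl le_rfl (min_le_left _ _) (by omega) (hSa s hs)
  have hSb' : ∀ s ∈ Sb, s.1 ∈ (range Rb ×ˢ range T₀).image
      (fun q : ℕ × ℕ => (![a' + q.1, j₀ + q.2] : (Literature.Probability.LatticeModels.Site 2))) :=
    fun s hs => zbox_mono le_rfl le_rfl (min_le_right _ _) (by omega) (hSb s hs)
  -- the rate
  set mH : ℝ := ∫ g, Real.exp (-(β * ((N : ℝ) - (ρ g).trace.re))) ∂(haarProbability G) with hmH
  set q : ℝ := 1 - Real.exp (-(|β| * (N + B))) / mH with hq_def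
  have hw : Continuous fun g : G => Real.exp (-(β * ((N : ℝ) - (ρ g).trace.re))) := by
    have := Complex.continuous_re.comp hρ.matrix_trace
    fun_prop
  have hbound : ∀ g : G, |β * ((N : ℝ) - (ρ g).trace.re)| ≤ |β| * (N + B) := fun g => by
    rw [abs_mul]
    refine mul_le_mul_of_nonneg_left ?_ (abs_nonneg β)
    have h1 := hB g
    have h2 : |((N : ℝ) - (ρ g).trace.re)| ≤ |(N : ℝ)| + |(ρ g).trace.re| := abs_sub _ _
    rw [Nat.abs_cast] at h2
    linarith
  have hm_lo : Real.exp (-(|β| * (N + B))) ≤ mH := by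
    have h : ∫ _g : G, Real.exp (-(|β| * (N + B))) ∂(haarProbability G) ≤ mH :=
      integral_mono (integrable_const _) (integrable_haarProbability_of_continuous hw) fun g =>
        Real.exp_le_exp.mpr (by linarith [(abs_le.mp (hbound g)).2])
    simpa using h
  have hm_pos : 0 < mH := lt_of_lt_of_le (Real.exp_pos _) hm_lo
  have hq0 : 0 ≤ q := by rw [hq_def, sub_nonneg]; exact (div_le_one hm_pos).mpr hm_lo
  have hq1 : q < 1 := by
    have : 0 < Real.exp (-(|β| * (N + B))) / mH := div_pos (Real.exp_pos _) hm_pos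
    rw [hq_def]; linarith
  -- the bound of part VIII-b, for all large `L`
  set K : ℝ := 6 * Ca * Cb * Real.exp (2 * (|β| * (N + B))) with hK
  have hmain : ∀ᶠ L : ℕ in atTop,
      |wilsonExpectation (L := L + 1) ρ β
            (fun U => toTorusObservable (L + 1) Fa U * toTorusObservable (L + 1) Fb U) -
          wilsonExpectation (L := L + 1) ρ β (toTorusObservable (L + 1) Fa) *
            wilsonExpectation (L := L + 1) ρ β (toTorusObservable (L + 1) Fb)| ≤
        K * q ^ ((L + 1) ^ 2 - (Ra + k + Rb) * T₀ - 1) := by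
    filter_upwards [Filter.eventually_ge_atTop (Ra + k + Rb + T₀ + 1)] with L hL
    have hcorner : ((a' : ℤ) : ZMod (L + 1)) =
        (a : ZMod (L + 1)) + (Ra : ZMod (L + 1)) + (k : ZMod (L + 1)) := by
      rw [ha']; push_cast; ring
    have hloca : ∀ (e : Edge 2 (L + 1)) (U : GaugeConfig 2 (L + 1) G) (g : G),
        (∀ p ∈ (range Ra ×ˢ range T₀).image
            (fun q : ℕ × ℕ => (![(a : ZMod (L + 1)) + q.1, (j₀ : ZMod (L + 1)) + q.2] : Site 2 (L + 1))),
          ((p, 0) : Edge 2 (L + 1)) ≠ e ∧ ((Site.shift p 0, 1) : Edge 2 (L + 1)) ≠ e ∧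
            ((Site.shift p 1, 0) : Edge 2 (L + 1)) ≠ e ∧ ((p, 1) : Edge 2 (L + 1)) ≠ e) →
        toTorusObservable (L + 1) Fa (update U e g) = toTorusObservable (L + 1) Fa U :=
      fun e U g he => toTorusObservable_update_eq hFa (L + 1) hSa' U g he
    have hlocb : ∀ (e : Edge 2 (L + 1)) (U : GaugeConfig 2 (L + 1) G) (g : G),
        (∀ p ∈ (range Rb ×ˢ range T₀).image
            (fun q : ℕ × ℕ => (![(a : ZMod (L + 1)) + Ra + k + q.1, (j₀ : ZMod (L + 1)) + q.2] :
              Site 2 (L + 1))),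
          ((p, 0) : Edge 2 (L + 1)) ≠ e ∧ ((Site.shift p 0, 1) : Edge 2 (L + 1)) ≠ e ∧
            ((Site.shift p 1, 0) : Edge 2 (L + 1)) ≠ e ∧ ((p, 1) : Edge 2 (L + 1)) ≠ e) →
        toTorusObservable (L + 1) Fb (update U e g) = toTorusObservable (L + 1) Fb U := by
      intro e U g he
      refine toTorusObservable_update_eq hFb (L + 1) hSb' U g fun p hp => he p ?_
      rwa [hcorner] at hp
    have h := abs_wilsonExpectation_mul_sub_mul_le_of_col_gap (L := L + 1) ρ hρ β hB (by omega)
      (a : ZMod (L + 1)) (j₀ : ZMod (L + 1)) (c₁ := Ra) (k := k) (R₂ := Rb) (T₀ := T₀) hk0 (by omega)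
      (by omega) (continuous_toTorusObservable (L + 1) hca) (continuous_toTorusObservable (L + 1) hcb)
      hloca hlocb (fun U => hba _) (fun U => hbb _)
    refine h.trans (le_of_eq ?_)
    simp only [hK, hq_def, hmH]
  -- the rate tends to zero
  have hexp : Tendsto (fun L : ℕ => (L + 1) ^ 2 - (Ra + k + Rb) * T₀ - 1) atTop atTop := by
    refine tendsto_atTop_atTop.mpr fun n => ⟨n + (Ra + k + Rb) * T₀ + 1, fun L hL => ?_⟩
    have : L + 1 ≤ (L + 1) ^ 2 := Nat.le_self_pow (by norm_num) _
    omega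
  have hpow : Tendsto (fun L : ℕ => K * q ^ ((L + 1) ^ 2 - (Ra + k + Rb) * T₀ - 1)) atTop (𝓝 0) := by
    have h := (tendsto_pow_atTop_nhds_zero_of_lt_one hq0 hq1).comp hexp
    simpa using h.const_mul K
  filter_upwards [hmain, Filter.Tendsto.eventually_le_const hδ hpow] with L h1 h2
  exact h1.trans h2

/-- **ROW-SEPARATED CYLINDER OBSERVABLES**: if the support boxes of `Fa` (rows `[b, b + Ta)`) and `Fb`
(rows `[b', b' + Tb)`) satisfy `b + Ta + 1 ≤ b'`, then for every `δ > 0`, for all large `L`,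
`|⟨Φa Φb⟩_{L+1} − ⟨Φa⟩_{L+1} ⟨Φb⟩_{L+1}| ≤ δ` (`Φ = toTorusObservable (L+1) F`; in fact the covariance is
`O(θ^{(L+1)²})`, part VIII-rb). -/
theorem eventually_abs_cov_le_of_row_sep (hρ : Continuous ρ) (β : ℝ) {Fa Fb : LGConfig 2 G → ℝ}
    {Sa Sb : Finset ((Literature.MathematicalPhysics.QuantumLattice.ZdEdge 2))} (hFa : IsCylinder Fa Sa)
    (hFb : IsCylinder Fb Sb) (hca : Continuous Fa) (hcb : Continuous Fb) {Ca Cb : ℝ}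
    (hba : ∀ U, |Fa U| ≤ Ca) (hbb : ∀ U, |Fb U| ≤ Cb) {a b a' b' : ℤ} {Ra Ta Rb Tb : ℕ}
    (hSa : ∀ s ∈ Sa, s.1 ∈ (range Ra ×ˢ range Ta).image
      (fun q : ℕ × ℕ => (![a + q.1, b + q.2] : (Literature.Probability.LatticeModels.Site 2))))
    (hSb : ∀ s ∈ Sb, s.1 ∈ (range Rb ×ˢ range Tb).image
      (fun q : ℕ × ℕ => (![a' + q.1, b' + q.2] : (Literature.Probability.LatticeModels.Site 2))))
    (hgap : b + Ta + 1 ≤ b') {δ : ℝ} (hδ : 0 < δ) :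
    ∀ᶠ L : ℕ in atTop,
      |wilsonExpectation (L := L + 1) ρ β
            (fun U => toTorusObservable (L + 1) Fa U * toTorusObservable (L + 1) Fb U) -
          wilsonExpectation (L := L + 1) ρ β (toTorusObservable (L + 1) Fa) *
            wilsonExpectation (L := L + 1) ρ β (toTorusObservable (L + 1) Fb)| ≤ δ := by
  obtain ⟨B, hB0, hB⟩ := exists_bound_trace_re_nonneg ρ hρ
  -- common column band and the gap
  set i₀ : ℤ := min a a' with hi₀
  set R₀ : ℕ := (max (a + Ra) (a' + Rb) - i₀).toNat with hR₀
  set k : ℕ := (b' - b - Ta).toNat with hk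
  have hk0 : 0 < k := by omega
  have hb' : b' = b + Ta + k := by omega
  have hSa' : ∀ s ∈ Sa, s.1 ∈ (range R₀ ×ˢ range Ta).image
      (fun q : ℕ × ℕ => (![i₀ + q.1, b + q.2] : (Literature.Probability.LatticeModels.Site 2))) :=
    fun s hs => zbox_mono (min_le_left _ _) (by omega) le_rfl le_rfl (hSa s hs)
  have hSb' : ∀ s ∈ Sb, s.1 ∈ (range R₀ ×ˢ range Tb).image
      (fun q : ℕ × ℕ => (![i₀ + q.1, b' + q.2] : (Literature.Probability.LatticeModels.Site 2))) :=
    fun s hs => zbox_mono (min_le_right _ _) (by omega) le_rfl le_rfl (hSb s hs)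
  -- the rate
  set mH : ℝ := ∫ g, Real.exp (-(β * ((N : ℝ) - (ρ g).trace.re))) ∂(haarProbability G) with hmH
  set q : ℝ := 1 - Real.exp (-(|β| * (N + B))) / mH with hq_def
  have hw : Continuous fun g : G => Real.exp (-(β * ((N : ℝ) - (ρ g).trace.re))) := by
    have := Complex.continuous_re.comp hρ.matrix_trace
    fun_prop
  have hbound : ∀ g : G, |β * ((N : ℝ) - (ρ g).trace.re)| ≤ |β| * (N + B) := fun g => by
    rw [abs_mul]
    refine mul_le_mul_of_nonneg_left ?_ (abs_nonneg β)
    have h1 := hB g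
    have h2 : |((N : ℝ) - (ρ g).trace.re)| ≤ |(N : ℝ)| + |(ρ g).trace.re| := abs_sub _ _
    rw [Nat.abs_cast] at h2
    linarith
  have hm_lo : Real.exp (-(|β| * (N + B))) ≤ mH := by
    have h : ∫ _g : G, Real.exp (-(|β| * (N + B))) ∂(haarProbability G) ≤ mH :=
      integral_mono (integrable_const _) (integrable_haarProbability_of_continuous hw) fun g =>
        Real.exp_le_exp.mpr (by linarith [(abs_le.mp (hbound g)).2])
    simpa using h
  have hm_pos : 0 < mH := lt_of_lt_of_le (Real.exp_pos _) hm_lo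
  have hq0 : 0 ≤ q := by rw [hq_def, sub_nonneg]; exact (div_le_one hm_pos).mpr hm_lo
  have hq1 : q < 1 := by
    have : 0 < Real.exp (-(|β| * (N + B))) / mH := div_pos (Real.exp_pos _) hm_pos
    rw [hq_def]; linarith
  -- the bound of part VIII-b, for all large `L`
  set K : ℝ := 6 * Ca * Cb * Real.exp (2 * (|β| * (N + B))) with hK
  have hmain : ∀ᶠ L : ℕ in atTop,
      |wilsonExpectation (L := L + 1) ρ β
            (fun U => toTorusObservable (L + 1) Fa U * toTorusObservable (L + 1) Fb U) -
          wilsonExpectation (L := L + 1) ρ β (toTorusObservable (L + 1) Fa) *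
            wilsonExpectation (L := L + 1) ρ β (toTorusObservable (L + 1) Fb)| ≤
        K * q ^ ((L + 1) ^ 2 - R₀ * (Ta + k + Tb) - 1) := by
    filter_upwards [Filter.eventually_ge_atTop (Ta + k + Tb + R₀ + 1)] with L hL
    have hcorner : ((b' : ℤ) : ZMod (L + 1)) =
        (b : ZMod (L + 1)) + (Ta : ZMod (L + 1)) + (k : ZMod (L + 1)) := by
      rw [hb']; push_cast; ring
    have hloca : ∀ (e : Edge 2 (L + 1)) (U : GaugeConfig 2 (L + 1) G) (g : G),
        (∀ p ∈ (range R₀ ×ˢ range Ta).image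
            (fun q : ℕ × ℕ => (![(i₀ : ZMod (L + 1)) + q.1, (b : ZMod (L + 1)) + q.2] : Site 2 (L + 1))),
          ((p, 0) : Edge 2 (L + 1)) ≠ e ∧ ((Site.shift p 0, 1) : Edge 2 (L + 1)) ≠ e ∧
            ((Site.shift p 1, 0) : Edge 2 (L + 1)) ≠ e ∧ ((p, 1) : Edge 2 (L + 1)) ≠ e) →
        toTorusObservable (L + 1) Fa (update U e g) = toTorusObservable (L + 1) Fa U :=
      fun e U g he => toTorusObservable_update_eq hFa (L + 1) hSa' U g he
    have hlocb : ∀ (e : Edge 2 (L + 1)) (U : GaugeConfig 2 (L + 1) G) (g : G),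
        (∀ p ∈ (range R₀ ×ˢ range Tb).image
            (fun q : ℕ × ℕ => (![(i₀ : ZMod (L + 1)) + q.1, (b : ZMod (L + 1)) + Ta + k + q.2] :
              Site 2 (L + 1))),
          ((p, 0) : Edge 2 (L + 1)) ≠ e ∧ ((Site.shift p 0, 1) : Edge 2 (L + 1)) ≠ e ∧
            ((Site.shift p 1, 0) : Edge 2 (L + 1)) ≠ e ∧ ((p, 1) : Edge 2 (L + 1)) ≠ e) →
        toTorusObservable (L + 1) Fb (update U e g) = toTorusObservable (L + 1) Fb U := by
      intro e U g he
      refine toTorusObservable_update_eq hFb (L + 1) hSb' U g fun p hp => he p ?_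
      rwa [hcorner] at hp
    have h := abs_wilsonExpectation_mul_sub_mul_le_of_row_gap (L := L + 1) ρ hρ β hB (by omega)
      (i₀ : ZMod (L + 1)) (b : ZMod (L + 1)) (c₁ := Ta) (k := k) (T₂ := Tb) (R₀ := R₀) hk0 (by omega)
      (by omega) (continuous_toTorusObservable (L + 1) hca) (continuous_toTorusObservable (L + 1) hcb)
      hloca hlocb (fun U => hba _) (fun U => hbb _)
    refine h.trans (le_of_eq ?_)
    simp only [hK, hq_def, hmH]
  -- the rate tends to zero
  have hexp : Tendsto (fun L : ℕ => (L + 1) ^ 2 - R₀ * (Ta + k + Tb) - 1) atTop atTop := by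
    refine tendsto_atTop_atTop.mpr fun n => ⟨n + R₀ * (Ta + k + Tb) + 1, fun L hL => ?_⟩
    have : L + 1 ≤ (L + 1) ^ 2 := Nat.le_self_pow (by norm_num) _
    omega
  have hpow : Tendsto (fun L : ℕ => K * q ^ ((L + 1) ^ 2 - R₀ * (Ta + k + Tb) - 1)) atTop (𝓝 0) := by
    have h := (tendsto_pow_atTop_nhds_zero_of_lt_one hq0 hq1).comp hexp
    simpa using h.const_mul K
  filter_upwards [hmain, Filter.Tendsto.eventually_le_const hδ hpow] with L h1 h2
  exact h1.trans h2

end Separated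

end Summit.Ventures.LatticeQCDFlow.Scoring
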